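import Literature.AlgebraicGeometry.Resolution.MonoidalTransformRegular
import Literature.AlgebraicGeometry.Resolution.MonoidalTransformCentre
import Literature.AlgebraicGeometry.Resolution.MonoidalTransformMonomials
import HarnessLib

/-!
# One monoidal transform along a valuation: regularity, new parameters, monomial bookkeeping ([CoP1] §8)

Topic: `Literature/AlgebraicGeometry/Resolution`. PROOF side of `CossartPiltant2019ReductionP`
(`ArithmeticalThreefoldsLocal.lean`), input (C4): the head of the decomposition layer of
[CoP1] Prop. 9.3 is [CoP1] Prop. 8.1 (`DecompositionLayerStrictParameters.lean`). Its proof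
(HAL hal-00139124, pp. 22–24: the `E = F` reduction and Lemma 8.2) iterates ONE STEP: the
monoidal transform of a local uniformization `S₂` at `(y_a, y_b)` along the valuation, in the
chart `y_b = y_a · z`, `z = y_b / y_a ∈ O`. This file packages that step in the tree's currency
(`R ⊆ O` a regular local subring of the field `K` with regular system of parameters `x`,
`R₁ = locAtCentre R[z] O`), assembling `MonoidalTransformRegular.lean` (regularity),
`MonoidalTransformCentre.lean` (the new regular system of parameters) and
`MonoidalTransformMonomials.lean` (exponents):

* `exists_monoidalStep_of_valuation_lt_one` — **case `v(z) > 0`** ("`W y_{i₂} > W y_{i₁}`",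
  or "`W y_{i₂} < W y_{i₁}`" with the roles exchanged): `R₁` is a regular local ring dominated
  by `O` with regular system of parameters `x′ = x[b ↦ z]`, and every monomial `∏ x_c^{α_c}`
  equals `∏ x′_c^{α′_c}`, `α′ = α[a ↦ α_a + α_b]`;
* `exists_monoidalStep_of_valuation_eq_one` — **case `v(z) = 0`**: `R₁` is a regular local ring
  with regular system of parameters `x′ = x[b ↦ P(z)]` (`P` monic), `z` is a unit of `R₁`,
  and `∏ x_c^{α_c} = z^{α_b} ∏ x′_c^{α″_c}`, `α″ = α[a ↦ α_a + α_b][b ↦ 0]`.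

Everything is PROVED; no named facts, definitions, instances or notation are introduced.

## Sources

* V. Cossart, O. Piltant, J. Algebra 320 (2008) 1051–1082: proof of Prop. 8.1 and Lemma 8.2
  (HAL hal-00139124, pp. 22–24). [CossartPiltant2008]
-/

noncomputable section

namespace Literature.AlgebraicGeometry.Resolution

universe u

open IsLocalRing Polynomial

variable {K : Type u} [Field K]

section Step

variable (R : Subring K) [IsRegularLocalRing R] {d : ℕ}
  (hd : (maximalIdeal R).spanFinrank = d) (x : Fin d → R)
  (hx : Ideal.span (Set.range x) = maximalIdeal R)
  (O : ValuationSubring K) (hRO : R ≤ O.toSubring)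

include hd hx in
/-- Members of a regular system of parameters are non-zero (in `K`). [folklore] -/
private theorem coe_rsop_ne_zero (a : Fin d) : ((x a : R) : K) ≠ 0 := by
  intro h
  have hnot : a ∉ (∅ : Set (Fin d)) := Set.notMem_empty _
  have := not_mem_span_image_of_not_mem hd x hx hnot
  rw [Set.image_empty, Ideal.span_empty] at this
  exact this (by rw [show x a = 0 from Subtype.ext h]; exact Submodule.zero_mem ⊥)

omit [IsRegularLocalRing R] in
include hRO in
/-- `R[z] ⊆ O` for `z ∈ O`. [folklore] -/
private theorem adjoin_singleton_le_valuationSubring {z : K} (hz : z ∈ O) :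
    (Algebra.adjoin R {z}).toSubring ≤ O.toSubring := by
  let OS : Subalgebra R K := { O.toSubring with algebraMap_mem' := fun r => hRO r.2 }
  have h : Algebra.adjoin R {z} ≤ OS := Algebra.adjoin_le (Set.singleton_subset_iff.mpr hz)
  exact fun y hy => h hy

omit [IsRegularLocalRing R] in
/-- `R[x_b/x_a]` is the chart `R[x_a/x_a, x_b/x_a]` of the blowing up along `(x_a, x_b)`.
[folklore] -/
private theorem closure_pair_eq_adjoin (a b : Fin d) (hxa : ((x a : R) : K) ≠ 0) :
    Subring.closure ((R : Set K) ∪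
        Set.range fun j : Fin 2 => ((x (![a, b] j) : R) : K) / ((x (![a, b] 0) : R) : K)) =
      (Algebra.adjoin R {((x b : R) : K) / ((x a : R) : K)}).toSubring := by
  have hrange : ∀ j : Fin 2, ((x (![a, b] j) : R) : K) / ((x (![a, b] 0) : R) : K) ∈
      Algebra.adjoin R {((x b : R) : K) / ((x a : R) : K)} := by
    refine Fin.forall_fin_two.mpr ⟨?_, ?_⟩
    · change ((x a : R) : K) / ((x a : R) : K) ∈ _
      rw [div_self hxa]
      exact Subalgebra.one_mem _
    · exact Algebra.self_mem_adjoin_singleton R _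
  refine le_antisymm (Subring.closure_le.mpr ?_) ?_
  · rintro y (hy | ⟨j, rfl⟩)
    · exact (Algebra.adjoin R _).algebraMap_mem ⟨y, hy⟩
    · exact hrange j
  · let C : Subalgebra R K :=
      { Subring.closure ((R : Set K) ∪
          Set.range fun j : Fin 2 => ((x (![a, b] j) : R) : K) / ((x (![a, b] 0) : R) : K)) with
        algebraMap_mem' := fun r => Subring.subset_closure (Or.inl r.2) }
    have h : Algebra.adjoin R {((x b : R) : K) / ((x a : R) : K)} ≤ C :=
      Algebra.adjoin_le (Set.singleton_subset_iff.mpr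
        (Subring.subset_closure (Or.inr ⟨1, by simp⟩)))
    exact fun y hy => h hy

include hd hx hRO in
/-- **Regularity of the monoidal transform `locAtCentre R[x_b/x_a] O`** (chart containing the
centre: `v(x_b) ≤ v(x_a)`). [cite: CossartPiltant2008, proof of Prop. 8.1 (HAL p. 23)] -/
theorem isRegularLocalRing_locAtCentre_adjoin_div (a b : Fin d) (hab : a ≠ b)
    (hle : O.valuation ((x b : R) : K) ≤ O.valuation ((x a : R) : K)) :
    IsRegularLocalRing
      (locAtCentre (Algebra.adjoin R {((x b : R) : K) / ((x a : R) : K)}).toSubring O) := by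
  have hxa := coe_rsop_ne_zero R hd x hx a
  have he : Function.Injective (![a, b] : Fin 2 → Fin d) := by
    intro i j hij
    fin_cases i <;> fin_cases j
    · rfl
    · exact absurd hij (by simpa using hab)
    · exact absurd hij (by simpa using hab.symm)
    · rfl
  have hmin : ∀ j : Fin 2, O.valuation ((x (![a, b] j) : R) : K) ≤
      O.valuation ((x (![a, b] 0) : R) : K) := by
    intro j
    fin_cases j
    · exact le_rfl
    · simpa using hle
  have h := isRegularLocalRing_locAtCentre_monoidalChart R hd x hx ![a, b] he 0 O hRO hmin
  rw [closure_pair_eq_adjoin R x a b hxa] at h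
  exact h

include hd hx hRO in
/-- **One monoidal transform, case `v(x_b/x_a) > 0`.** `R ⊆ O` regular local with regular
system of parameters `x`, dominated by `O` with algebraic residue extension; `a ≠ b` with
`v(x_b/x_a) > 0`. Then `R₁ = locAtCentre R[x_b/x_a] O ⊆ O` is a regular local ring, the family
`x′ = x[b ↦ x_b/x_a]` is a regular system of parameters of `R₁` (it generates `𝔪_{R₁}`), and
`∏ x_c^{α_c} = ∏ x′_c^{α[a ↦ α_a+α_b]_c}` for every exponent vector `α`
([CoP1] HAL p. 23, "`(y_{i₃}, y_{i₁}/y_{i₂}, y_{i₂})` is a r.s.p.", `E⁽¹⁾`, `F⁽¹⁾`).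
[cite: CossartPiltant2008, proof of Prop. 8.1 (HAL p. 23)] -/
theorem exists_monoidalStep_of_valuation_lt_one
    (hdom : ∀ r : R, r ∈ maximalIdeal R → O.valuation (r : K) < 1)
    (halg : ∀ y : O, ∃ q : R[X], (∃ k, q.coeff k ∉ maximalIdeal R) ∧
      O.valuation (aeval (y : K) q) < 1)
    (a b : Fin d) (hab : a ≠ b) (hlt : O.valuation (((x b : R) : K) / ((x a : R) : K)) < 1) :
    ∃ (hBO : (Algebra.adjoin R {((x b : R) : K) / ((x a : R) : K)}).toSubring ≤ O.toSubring),
      IsRegularLocalRing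
        (locAtCentre (Algebra.adjoin R {((x b : R) : K) / ((x a : R) : K)}).toSubring O) ∧
      ∃ x' : Fin d → locAtCentre (Algebra.adjoin R {((x b : R) : K) / ((x a : R) : K)}).toSubring O,
        (∀ c, c ≠ b → (x' c : K) = ((x c : R) : K)) ∧
        ((x' b : K) = ((x b : R) : K) / ((x a : R) : K)) ∧
        (haveI := isLocalRing_locAtCentre hBO
         Ideal.span (Set.range x') =
           maximalIdeal (locAtCentre (Algebra.adjoin R
             {((x b : R) : K) / ((x a : R) : K)}).toSubring O)) ∧
        ∀ α : Fin d → ℕ, (∏ c, ((x c : R) : K) ^ α c) =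
          ∏ c, (x' c : K) ^ Function.update α a (α a + α b) c := by
  classical
  have hxa := coe_rsop_ne_zero R hd x hx a
  set z : K := ((x b : R) : K) / ((x a : R) : K) with hzdef
  have hzO : z ∈ O := (O.valuation_le_one_iff _).mp hlt.le
  have hBO := adjoin_singleton_le_valuationSubring R O hRO hzO
  have hle : O.valuation ((x b : R) : K) ≤ O.valuation ((x a : R) : K) := by
    have heq : ((x b : R) : K) = z * ((x a : R) : K) := by rw [hzdef, div_mul_cancel₀ _ hxa]
    rw [heq, map_mul]
    exact mul_le_of_le_one_left zero_le hlt.le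
  refine ⟨hBO, isRegularLocalRing_locAtCentre_adjoin_div R hd x hx O hRO a b hab hle, ?_⟩
  haveI := isLocalRing_locAtCentre hBO
  set B : Subalgebra R K := Algebra.adjoin R {z} with hBdef
  let xR : Fin d → locAtCentre B.toSubring O :=
    fun c => ⟨((x c : R) : K), le_locAtCentre _ _ (B.algebraMap_mem (x c))⟩
  let zR : locAtCentre B.toSubring O :=
    ⟨z, le_locAtCentre _ _ (Algebra.self_mem_adjoin_singleton R z)⟩
  refine ⟨Function.update xR b zR, fun c hc => ?_, ?_, ?_, fun α => ?_⟩
  · rw [Function.update_of_ne hc]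
  · rw [Function.update_self]
  · have hmax := maximalIdeal_locAtCentre_monoidal_of_valuation_lt_one R O hRO hdom halg x hx a b
      hab hxa hlt hBO
    rw [hmax]
    refine le_antisymm (Ideal.span_le.mpr ?_) (Ideal.span_le.mpr ?_)
    · rintro _ ⟨c, rfl⟩
      by_cases hcb : c = b
      · subst hcb
        rw [Function.update_self]
        exact Ideal.subset_span (Or.inr rfl)
      · rw [Function.update_of_ne hcb]
        exact Ideal.subset_span (Or.inl ⟨⟨c, hcb⟩, rfl⟩)
    · rintro _ (⟨c, rfl⟩ | h)
      · have : xR c = Function.update xR b zR c := by rw [Function.update_of_ne c.2]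
        change xR (c : Fin d) ∈ Ideal.span (Set.range (Function.update xR b zR))
        rw [this]
        exact Ideal.subset_span ⟨(c : Fin d), rfl⟩
      · rw [Set.mem_singleton_iff] at h
        subst h
        exact Ideal.subset_span ⟨b, Function.update_self b zR xR⟩
  · rw [prod_pow_eq_prod_update_div_pow_update (fun c => ((x c : R) : K)) α hab hxa]
    refine Finset.prod_congr rfl fun c _ => ?_
    by_cases hcb : c = b
    · subst hcb
      rw [Function.update_self, Function.update_self]
    · rw [Function.update_of_ne hcb, Function.update_of_ne hcb]

include hd hx hRO in
/-- **One monoidal transform, case `v(x_b/x_a) = 0`.** Same setting with `v(x_b) = v(x_a)`: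
`R₁ = locAtCentre R[x_b/x_a] O` is a regular local ring, `z = x_b/x_a` is a unit of `R₁`,
`x′ = x[b ↦ P(z)]` generates `𝔪_{R₁}` for a monic `P ∈ R[X]`, and
`∏ x_c^{α_c} = z^{α_b} · ∏ x′_c^{α[a ↦ α_a+α_b][b ↦ 0]_c}` for every `α`
([CoP1] HAL p. 23, "`(y_{i₃}, y_{i₁}, P(y_{i₂}/y_{i₁}))` is a r.s.p.", `i₂` leaves `E` and `F`).
[cite: CossartPiltant2008, proof of Prop. 8.1 (HAL p. 23)] -/
theorem exists_monoidalStep_of_valuation_eq_one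
    (hdom : ∀ r : R, r ∈ maximalIdeal R → O.valuation (r : K) < 1)
    (halg : ∀ y : O, ∃ q : R[X], (∃ k, q.coeff k ∉ maximalIdeal R) ∧
      O.valuation (aeval (y : K) q) < 1)
    (a b : Fin d) (hab : a ≠ b) (h1 : O.valuation (((x b : R) : K) / ((x a : R) : K)) = 1) :
    ∃ (hBO : (Algebra.adjoin R {((x b : R) : K) / ((x a : R) : K)}).toSubring ≤ O.toSubring),
      IsRegularLocalRing
        (locAtCentre (Algebra.adjoin R {((x b : R) : K) / ((x a : R) : K)}).toSubring O) ∧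
      IsUnit (⟨((x b : R) : K) / ((x a : R) : K), le_locAtCentre _ _
          (Algebra.self_mem_adjoin_singleton R _)⟩ :
        locAtCentre (Algebra.adjoin R {((x b : R) : K) / ((x a : R) : K)}).toSubring O) ∧
      ∃ x' : Fin d → locAtCentre (Algebra.adjoin R {((x b : R) : K) / ((x a : R) : K)}).toSubring O,
        (∀ c, c ≠ b → (x' c : K) = ((x c : R) : K)) ∧
        (haveI := isLocalRing_locAtCentre hBO
         Ideal.span (Set.range x') =
           maximalIdeal (locAtCentre (Algebra.adjoin R
             {((x b : R) : K) / ((x a : R) : K)}).toSubring O)) ∧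
        ∀ α : Fin d → ℕ, (∏ c, ((x c : R) : K) ^ α c) =
          (((x b : R) : K) / ((x a : R) : K)) ^ α b *
            ∏ c, (x' c : K) ^ Function.update (Function.update α a (α a + α b)) b 0 c := by
  classical
  have hxa := coe_rsop_ne_zero R hd x hx a
  set z : K := ((x b : R) : K) / ((x a : R) : K) with hzdef
  have hzO : z ∈ O := (O.valuation_le_one_iff _).mp h1.le
  have hBO := adjoin_singleton_le_valuationSubring R O hRO hzO
  have hle : O.valuation ((x b : R) : K) ≤ O.valuation ((x a : R) : K) := by
    have heq : ((x b : R) : K) = z * ((x a : R) : K) := by rw [hzdef, div_mul_cancel₀ _ hxa]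
    rw [heq, map_mul, h1, one_mul]
  refine ⟨hBO, isRegularLocalRing_locAtCentre_adjoin_div R hd x hx O hRO a b hab hle, ?_, ?_⟩
  · by_contra hnu
    have := (not_isUnit_locAtCentre_iff hBO _).mp hnu
    exact (lt_irrefl _) (h1 ▸ this)
  haveI := isLocalRing_locAtCentre hBO
  set B : Subalgebra R K := Algebra.adjoin R {z} with hBdef
  obtain ⟨P, -, -, hmax⟩ := exists_monic_maximalIdeal_locAtCentre_monoidal R O hRO hdom halg x
    hx a b hab hxa hle hBO
  let xR : Fin d → locAtCentre B.toSubring O :=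
    fun c => ⟨((x c : R) : K), le_locAtCentre _ _ (B.algebraMap_mem (x c))⟩
  let pR : locAtCentre B.toSubring O :=
    ⟨aeval z P, le_locAtCentre _ _ (Polynomial.aeval_mem_adjoin_singleton R _)⟩
  refine ⟨Function.update xR b pR, fun c hc => ?_, ?_, fun α => ?_⟩
  · rw [Function.update_of_ne hc]
  · rw [hmax]
    refine le_antisymm (Ideal.span_le.mpr ?_) (Ideal.span_le.mpr ?_)
    · rintro _ ⟨c, rfl⟩
      by_cases hcb : c = b
      · subst hcb
        rw [Function.update_self]
        exact Ideal.subset_span (Or.inr rfl)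
      · rw [Function.update_of_ne hcb]
        exact Ideal.subset_span (Or.inl ⟨⟨c, hcb⟩, rfl⟩)
    · rintro _ (⟨c, rfl⟩ | h)
      · have : xR c = Function.update xR b pR c := by rw [Function.update_of_ne c.2]
        change xR (c : Fin d) ∈ Ideal.span (Set.range (Function.update xR b pR))
        rw [this]
        exact Ideal.subset_span ⟨(c : Fin d), rfl⟩
      · rw [Set.mem_singleton_iff] at h
        subst h
        exact Ideal.subset_span ⟨b, Function.update_self b pR xR⟩
  · rw [prod_pow_eq_div_pow_mul_prod_pow_update (fun c => ((x c : R) : K)) α hab hxa]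
    congr 1
    refine Finset.prod_congr rfl fun c _ => ?_
    by_cases hcb : c = b
    · subst hcb
      rw [Function.update_self, pow_zero, pow_zero]
    · rw [Function.update_of_ne hcb, Function.update_of_ne hcb]

end Step

/-! ## Iterating: the transform of a local ring of a model is the local ring of a model -/

section Models

/-- **Monoidal transforms stay in the currency of models**: for `B ⊆ O` and a set `s ⊆ K`,
`locAtCentre ((locAtCentre B O)[s]) O = locAtCentre (B[s]) O` — the local blowing up of the
local ring `B_𝔪` is the local ring of the model `B[s]` (so dimension and finite generation over
the base are read off `B[s]`; [CoP1] §2.1 "local models", HAL pp. 8–9, and the iteration of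
monoidal transforms in the proof of Prop. 8.1). [cite: CossartPiltant2008, §2.1 and proof of Prop. 8.1 (HAL pp. 8–9, 23)] -/
theorem locAtCentre_closure_locAtCentre_union (B : Subring K) (O : ValuationSubring K)
    (s : Set K) :
    locAtCentre (Subring.closure ((locAtCentre B O : Set K) ∪ s)) O =
      locAtCentre (Subring.closure ((B : Set K) ∪ s)) O := by
  refine le_antisymm ?_ ?_
  · have h1 : Subring.closure ((locAtCentre B O : Set K) ∪ s) ≤
        locAtCentre (Subring.closure ((B : Set K) ∪ s)) O := by
      refine Subring.closure_le.mpr ?_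
      rintro y (hy | hy)
      · exact locAtCentre_mono O (fun b hb => Subring.subset_closure (Or.inl hb)) hy
      · exact le_locAtCentre _ O (Subring.subset_closure (Or.inr hy))
    have h2 := locAtCentre_mono O h1
    rwa [locAtCentre_locAtCentre] at h2
  · exact locAtCentre_mono O (Subring.closure_mono
      (Set.union_subset_union_left _ (fun b hb => le_locAtCentre B O hb)))

/-- The same for one new element, in `Algebra.adjoin` form: for a model `T = S[t]` (any
subalgebra) with local ring `R = locAtCentre T O`, `locAtCentre (R[z]) O = locAtCentre (T[z]) O`
where `T[z] = S[t ∪ {z}]`. [cite: CossartPiltant2008, §2.1 and proof of Prop. 8.1 (HAL pp. 8–9, 23)] -/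
theorem locAtCentre_adjoin_locAtCentre_eq {S : Type u} [CommRing S] [Algebra S K]
    (T : Subalgebra S K) (O : ValuationSubring K) (z : K) :
    locAtCentre (Algebra.adjoin (locAtCentre T.toSubring O) {z}).toSubring O =
      locAtCentre (Algebra.adjoin S ((T : Set K) ∪ {z})).toSubring O := by
  have h1 : (Algebra.adjoin (locAtCentre T.toSubring O) {z}).toSubring =
      Subring.closure ((locAtCentre T.toSubring O : Set K) ∪ {z}) := by
    rw [Algebra.adjoin_eq_ring_closure]
    congr 2
    ext y
    constructor
    · rintro ⟨w, rfl⟩; exact w.2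
    · intro hy; exact ⟨⟨y, hy⟩, rfl⟩
  have h2 : (Algebra.adjoin S ((T : Set K) ∪ {z})).toSubring =
      Subring.closure ((T.toSubring : Set K) ∪ {z}) := by
    rw [Algebra.adjoin_eq_ring_closure]
    refine le_antisymm (Subring.closure_le.mpr ?_) (Subring.closure_mono ?_)
    · rintro y (⟨r, rfl⟩ | hy)
      · exact Subring.subset_closure (Or.inl (T.algebraMap_mem r))
      · exact Subring.subset_closure hy
    · exact Set.subset_union_right
  rw [h1, h2]
  exact locAtCentre_closure_locAtCentre_union T.toSubring O {z}

/-- **Rescaling a new generator by a unit of the local ring does not change the transform**: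
for `s ∈ S[t]` of value `0` (a unit of `locAtCentre S[t] O`),
`locAtCentre S[t ∪ {z·s}] O = locAtCentre S[t ∪ {z}] O`. (Used to choose model generators
inside `S₀[1/f]` — [CoP1] Prop. 8.1 (1) — e.g. `z·s = y/f` with `y ∈ S[t]`.)
[cite: CossartPiltant2008, Prop. 8.1 (1) and §2.1 (HAL pp. 8–9, 22)] -/
theorem locAtCentre_adjoin_insert_mul_eq {S : Type u} [CommRing S] [Algebra S K]
    (t : Set K) (O : ValuationSubring K) (z s : K) (hs : s ∈ Algebra.adjoin S t)
    (hvs : O.valuation s = 1) :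
    locAtCentre (Algebra.adjoin S (insert (z * s) t)).toSubring O =
      locAtCentre (Algebra.adjoin S (insert z t)).toSubring O := by
  have key : ∀ (a b : K), b ∈ locAtCentre (Algebra.adjoin S (insert a t)).toSubring O →
      locAtCentre (Algebra.adjoin S (insert b t)).toSubring O ≤
        locAtCentre (Algebra.adjoin S (insert a t)).toSubring O := by
    intro a b hb
    have h1 : (Algebra.adjoin S (insert b t)).toSubring ≤
        locAtCentre (Algebra.adjoin S (insert a t)).toSubring O := by
      let C : Subalgebra S K :=
        { locAtCentre (Algebra.adjoin S (insert a t)).toSubring O with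
          algebraMap_mem' := fun r => le_locAtCentre _ _
            ((Algebra.adjoin S (insert a t)).algebraMap_mem r) }
      have : Algebra.adjoin S (insert b t) ≤ C := by
        refine Algebra.adjoin_le ?_
        rintro y (rfl | hy)
        · exact hb
        · exact le_locAtCentre _ _ (Algebra.subset_adjoin (Set.mem_insert_of_mem _ hy))
      exact fun y hy => this hy
    have h2 := locAtCentre_mono O h1
    rwa [locAtCentre_locAtCentre] at h2
  have hsz : s ∈ Algebra.adjoin S (insert z t) := Algebra.adjoin_mono (Set.subset_insert _ _) hs
  have hszs : s ∈ Algebra.adjoin S (insert (z * s) t) :=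
    Algebra.adjoin_mono (Set.subset_insert _ _) hs
  refine le_antisymm (key z (z * s) ?_) (key (z * s) z ?_)
  · exact Subring.mul_mem _ (le_locAtCentre _ _ (Algebra.subset_adjoin (Set.mem_insert _ _)))
      (le_locAtCentre _ _ hsz)
  · have hs0 : s ≠ 0 := ne_zero_of_valuation_eq_one hvs
    have hmem : (z * s) * s⁻¹ ∈ locAtCentre (Algebra.adjoin S (insert (z * s) t)).toSubring O :=
      Subring.mul_mem _ (le_locAtCentre _ _ (Algebra.subset_adjoin (Set.mem_insert _ _)))
        (inv_mem_locAtCentre (le_locAtCentre _ _ hszs) hvs)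
    rwa [mul_assoc, mul_inv_cancel₀ hs0, mul_one] at hmem

end Models

end Literature.AlgebraicGeometry.Resolution

end
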